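import Summits.QuantumFields.BalabanUV.InfraRed.StrongCouplingFrozenPlaqSpec

/-!
# Strong coupling, temporal axial gauge on the open-time slab — Dobrushin contraction of the frozen `SU(N)` energy
(part 2 of 5)

**observatory of the non-perturbative crossover; no mass-gap claim.**  Cell `pub-balaban`, build IR-3 v2
(two-front crossover ledger), IR-SC lineage, generation 13.  Part 2 of the SC-c door by complete temporal axial gauge
on the open-time slab (part 1 `StrongCouplingFrozenPlaqSpec`; parts 3–5 `StrongCouplingSlabAxialGauge`,
`StrongCouplingSlabAxialRows`, `StrongCouplingSlabAxialClustering`).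

THE MECHANISM (this part, abstract plaquette system `S`, gauge group `SU(N)`, Wilson log-weight `w_β` at tree coupling
`β`, frozen link set `F`).
* §1 The one-link laws of the weight specification of the FROZEN energy `E^F_{w_β}`: at a frozen link it is Haar whatever
  the boundary condition (the energy does not read the link: a constant tilt, `siteLaw_frozen_of_mem`); at a dynamic
  link it is the 't Hooft one-link law `ν_B(dg) ∝ exp(N Re tr(g B)) dg` with staple field `B = B_{freeze_F ω}(v)` read on
  the FROZEN boundary condition (`siteLaw_frozen_of_not_mem`; Shen–Zhu–Zhu CMP 400 (2023) (1.1)–(1.2) at one link).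
* §2 Hence the one-link modulus `OneLinkKRModulus N R K` makes this specification a Kantorovich–Rubinstein contraction
  with the tree's coefficients `K (|β|/N) n(v,y)` OFF the frozen set and coefficient `0` whenever `v ∈ F` or `y ∈ F`
  (`isKRContraction_frozen_su`): frozen rows vanish and frozen columns are deleted — this is where a gauge fixing lowers
  the Dobrushin row sums.
* §3 The covariance bound by DLR smoothing for the frozen `SU(N)` weight measure (`abs_integral_mul_sub_le_frozen_su`):
  the tree's `abs_integral_mul_sub_le_su` verbatim, with the row-sum bound `c` now a HYPOTHESIS on the frozen
  coefficients (supplied for the slab in part 4).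

Every statement is kernel-checked; nothing here moves any number of the ledger; no statement of the manuscripts under
audit is used.  References (framework only): [cite: Georgii2011, Def. 2.9, Thm. 8.7, §8.2]
[cite: Follmer1988, Ch. I Theorem (2.13), Remark (2.17)] [cite: arXiv220412737, (1.1)–(1.2), remark after Thm. 1.3].
-/

noncomputable section

open MeasureTheory ProbabilityTheory Filter Function Finset
open Literature.Probability.LatticeModels
open Literature.Probability.LatticeModels.DobrushinMetric
open Literature.MathematicalPhysics.QuantumFieldTheory
open Literature.MathematicalPhysics.QuantumFieldTheory.Balaban1983to89
open Literature.MathematicalPhysics.QuantumFieldTheory.Balaban1983to89.StrongCouplingDobrushinWindow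
open Literature.MathematicalPhysics.QuantumFieldTheory.Balaban1983to89.StrongCouplingTorusWindow
open Literature.MathematicalPhysics.QuantumFieldTheory.Balaban1983to89.StrongCouplingOpenWindow
open Literature.MathematicalPhysics.QuantumFieldTheory.Balaban1983to89.StrongCouplingOpenWindow.PlaqSystem (suWeight
  continuous_suWeight suSmoothLip)
open Summit.QuantumFields.BalabanUV.InfraRed.StrongCouplingFrozenPlaqSpec

namespace Summit.QuantumFields.BalabanUV.InfraRed.StrongCouplingFrozenPlaqKR

variable {V P : Type*} [Fintype V] [Fintype P] [DecidableEq V] (S : PlaqSystem V P) {N : ℕ} (F : Finset V)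

/-! ### §1 One-link laws of the frozen `SU(N)` weight specification -/

section SiteLaw

/-- **At a frozen link the one-link law is Haar**, whatever the boundary condition: the frozen energy does not read the
link, so the tilt is by a constant. [cite: Georgii2011, Def. 2.9] -/
theorem siteLaw_frozen_of_mem (β : ℝ) {v : V} (hv : v ∈ F) (ω : V → Matrix.specialUnitaryGroup (Fin N) ℂ) :
    siteLaw (weightSpec (frozenEnergy S F (suWeight N β))) v ω =
      haarProbability (Matrix.specialUnitaryGroup (Fin N) ℂ) := by
  haveI : SecondCountableTopology (Matrix (Fin N) (Fin N) ℂ) :=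
    inferInstanceAs (SecondCountableTopology (Fin N → Fin N → ℂ))
  haveI : SecondCountableTopology (Matrix.specialUnitaryGroup (Fin N) ℂ) :=
    Topology.IsEmbedding.subtypeVal.secondCountableTopology
  rw [siteLaw_weightSpec_eq_tilted (measurable_frozenEnergy S F (continuous_suWeight β)) v ω]
  simp_rw [frozenEnergy_update_of_mem S F _ hv]
  exact tilted_const _ _

/-- **At a dynamic link the one-link law is the 't Hooft law at the frozen boundary condition**:
`ν_{B}(dg) ∝ exp(N Re tr(g B)) dg` with `B = B_{freeze_F ω}(v)` (Shen–Zhu–Zhu CMP 400 (2023) (1.1)–(1.2) at one link; the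
tree's `siteLaw_thooft` read on the frozen configuration). [cite: arXiv220412737, (1.1)–(1.2)] -/
theorem siteLaw_frozen_of_not_mem (hN : 1 ≤ N) (β : ℝ) {v : V} (hv : v ∉ F)
    (ω : V → Matrix.specialUnitaryGroup (Fin N) ℂ) :
    siteLaw (weightSpec (frozenEnergy S F (suWeight N β))) v ω =
      (haarProbability (Matrix.specialUnitaryGroup (Fin N) ℂ)).tilted
        fun g => (N : ℝ) * ((g : Matrix (Fin N) (Fin N) ℂ) * S.field β v (freezeOn F ω)).trace.re := by
  haveI : SecondCountableTopology (Matrix (Fin N) (Fin N) ℂ) :=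
    inferInstanceAs (SecondCountableTopology (Fin N → Fin N → ℂ))
  haveI : SecondCountableTopology (Matrix.specialUnitaryGroup (Fin N) ℂ) :=
    Topology.IsEmbedding.subtypeVal.secondCountableTopology
  rw [siteLaw_weightSpec_eq_tilted (measurable_frozenEnergy S F (continuous_suWeight β)) v ω]
  have : (fun g : Matrix.specialUnitaryGroup (Fin N) ℂ => frozenEnergy S F (suWeight N β) (Function.update ω v g)) =
      fun g : Matrix.specialUnitaryGroup (Fin N) ℂ =>
        S.offEnergy β v (freezeOn F ω) +
          (N : ℝ) * ((g : Matrix (Fin N) (Fin N) ℂ) * S.field β v (freezeOn F ω)).trace.re := by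
    funext g
    rw [frozenEnergy_update_of_not_mem S F _ hv, S.energy_update_eq hN β v _ g]
  rw [this, tilted_const_add_eq]

end SiteLaw

/-! ### §2 The frozen specification is a Kantorovich–Rubinstein contraction with deleted frozen rows and columns -/

section Contraction

/-- The **frozen Dobrushin coefficients**: the tree's `K (|β|/N) n(v,y)` off the frozen set, `0` if `v` or `y` is frozen.
[folklore] -/
def frozenCoeff (K β : ℝ) (v y : V) : ℝ :=
  if v ∈ F ∨ y ∈ F then 0 else K * (|β| / N) * S.infl v y

omit [Fintype V] in
/-- Unfolding the frozen coefficients. [folklore] -/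
theorem frozenCoeff_apply (K β : ℝ) (v y : V) :
    frozenCoeff S (N := N) F K β v y = if v ∈ F ∨ y ∈ F then 0 else K * (|β| / N) * S.infl v y := rfl

omit [Fintype V] in
/-- The frozen coefficients are non-negative. [folklore] -/
theorem frozenCoeff_nonneg {K : ℝ} (hK : 0 ≤ K) (β : ℝ) (v y : V) : 0 ≤ frozenCoeff S (N := N) F K β v y := by
  unfold frozenCoeff
  split_ifs
  · exact le_rfl
  · exact mul_nonneg (by positivity) (S.infl_nonneg v y)

omit [Fintype V] in
/-- The frozen coefficients are dominated by the tree's coefficients. [folklore] -/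
theorem frozenCoeff_le {K : ℝ} (hK : 0 ≤ K) (β : ℝ) (v y : V) :
    frozenCoeff S (N := N) F K β v y ≤ K * (|β| / N) * S.infl v y := by
  unfold frozenCoeff
  split_ifs
  · exact mul_nonneg (by positivity) (S.infl_nonneg v y)
  · exact le_rfl

/-- **The one-link modulus gives Dobrushin's condition for the frozen plaquette system, with deleted frozen rows and
columns**: with `‖B‖_op ≤ (|β|/N) D ≤ R` (weighted degree `≤ D`; freezing only shrinks the staple field's entries to other
products of special unitary matrices, so the same bound holds) the modulus `OneLinkKRModulus N R K` makes the weight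
specification of the frozen energy a Kantorovich–Rubinstein contraction for the Frobenius distance over the plaquette
neighbours with coefficients `frozenCoeff`: a frozen row is Haar against Haar (coefficient `0`), a frozen column is not read
by the frozen staple field (coefficient `0`), and off `F` the tree's `isKRContraction_su` argument applies at the frozen
boundary conditions (Föllmer 1988 Ch. I Remark (2.17); Shen–Zhu–Zhu CMP 400 (2023), remark after Thm. 1.3).
[cite: Follmer1988, Ch. I Remark (2.17)] [cite: arXiv220412737, remark after Thm. 1.3 (Dobrushin route, p. 5)] -/
theorem isKRContraction_frozen_su (hN : 1 ≤ N) {β R K D : ℝ} (hK : 0 ≤ K) (hdeg : ∀ v, S.wdeg v ≤ D)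
    (hR : |β| / N * D ≤ R) (hmod : OneLinkKRModulus N R K) :
    IsKRContraction (weightSpec (frozenEnergy S F (suWeight N β))) suFrobDist S.nbr
      (frozenCoeff S (N := N) F K β) := by
  refine ⟨S.not_mem_nbr, frozenCoeff_nonneg S F hK β, fun v η η' h => ?_,
    fun v y _ ω η hωη φ L' hφm hφb hL' hφL => ?_⟩
  · by_cases hv : v ∈ F
    · rw [siteLaw_frozen_of_mem S F β hv η, siteLaw_frozen_of_mem S F β hv η']
    · rw [siteLaw_frozen_of_not_mem S F hN β hv η, siteLaw_frozen_of_not_mem S F hN β hv η',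
        S.field_congr β v fun z hz => freezeOn_apply_congr F fun _ => h z hz]
  · have hrhs0 : 0 ≤ frozenCoeff S (N := N) F K β v y * L' * suFrobDist (ω y) (η y) :=
      mul_nonneg (mul_nonneg (frozenCoeff_nonneg S F hK β v y) hL') (suFrobDist_nonneg _ _)
    by_cases hv : v ∈ F
    · rw [siteLaw_frozen_of_mem S F β hv ω, siteLaw_frozen_of_mem S F β hv η, sub_self, abs_zero]
      exact hrhs0
    · by_cases hyF : y ∈ F
      · have heq : freezeOn F ω = freezeOn F η :=
          freezeOn_congr F fun z hz => hωη z fun hzy => hz (hzy ▸ hyF)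
        rw [siteLaw_frozen_of_not_mem S F hN β hv ω, siteLaw_frozen_of_not_mem S F hN β hv η, heq, sub_self,
          abs_zero]
        exact hrhs0
      · rw [frozenCoeff_apply, if_neg (not_or.2 ⟨hv, hyF⟩), siteLaw_frozen_of_not_mem S F hN β hv ω,
          siteLaw_frozen_of_not_mem S F hN β hv η]
        have hBω := (S.matrixOpNorm_field_le hN β v (freezeOn F ω)).trans
          ((mul_le_mul_of_nonneg_left (hdeg v) (by positivity)).trans hR)
        have hBη := (S.matrixOpNorm_field_le hN β v (freezeOn F η)).trans
          ((mul_le_mul_of_nonneg_left (hdeg v) (by positivity)).trans hR)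
        have hωη' : ∀ z, z ≠ y → freezeOn F ω z = freezeOn F η z := fun z hz =>
          freezeOn_apply_congr F fun _ => hωη z hz
        refine (hmod _ _ hBω hBη φ L' hφm hφb hL' hφL).trans ?_
        calc K * L' * frobNorm (S.field β v (freezeOn F ω) - S.field β v (freezeOn F η))
            ≤ K * L' * (|β| / N * S.infl v y * suFrobDist (freezeOn F ω y) (freezeOn F η y)) :=
              mul_le_mul_of_nonneg_left (S.frobNorm_field_sub_le β v y hωη') (mul_nonneg hK hL')
          _ = K * (|β| / N) * S.infl v y * L' * suFrobDist (ω y) (η y) := by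
              rw [freezeOn_of_not_mem F hyF, freezeOn_of_not_mem F hyF]
              ring

end Contraction

/-! ### §3 Covariance bound by DLR smoothing for the frozen `SU(N)` weight measure -/

section Covariance

/-- The **frozen `SU(N)` weight measure** `Z_F⁻¹ exp(∑_q coef q · w_β((freeze_F U)_q)) ∏_v dU_v` of the plaquette system
at tree coupling `β` (product Haar on ALL links, energy read on the frozen configuration). [folklore] -/
def frozenSuMeasure (N : ℕ) (β : ℝ) : Measure (V → Matrix.specialUnitaryGroup (Fin N) ℂ) :=
  weightMeasure (frozenEnergy S F (suWeight N β))

/-- **Covariance bound by DLR smoothing for the frozen `SU(N)` plaquette system** (Föllmer 1988 Ch. I Thm. (2.13) with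
Remark (2.17), Georgii 2011 §8.2; the tree's `abs_integral_mul_sub_le_su` for the frozen energy): with one-link modulus
`OneLinkKRModulus N R K`, weighted degrees `≤ Dg`, `(|β|/N) Dg ≤ R`, FROZEN row sums `∑_y frozenCoeff(v,y) ≤ c ≤ 1`,
bounded measurable `f, g` depending on link sets `Δf, Δg` with `closure Δf` disjoint from `Δg`, and a profile `ℓ`
vanishing on `closure Δg` and `1`-Lipschitz along plaquette neighbours,
`|μ(fg) − μ(f)μ(g)| ≤ 2 (2√N)² (#closure Δg · M_g E) ∑_{y ∈ closure Δf} c^{ℓ y} M_f E` with the tree's smoothing factor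
`E = suSmoothLip N Dg β`. [cite: Follmer1988, Ch. I Theorem (2.13)] [cite: Georgii2011, Thm. 8.7, Thm. 8.20, §8.2] -/
theorem abs_integral_mul_sub_le_frozen_su (hN : 1 ≤ N) {β R K c Dg : ℝ} (hK : 0 ≤ K) (hDg : 0 ≤ Dg)
    (hdeg : ∀ v, S.wdeg v ≤ Dg) (hR : |β| / N * Dg ≤ R) (hmod : OneLinkKRModulus N R K)
    (hrow : ∀ v, ∑ y ∈ S.nbr v, frozenCoeff S (N := N) F K β v y ≤ c) (hc0 : 0 ≤ c) (hc1 : c ≤ 1)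
    {f g : (V → Matrix.specialUnitaryGroup (Fin N) ℂ) → ℝ} (hfm : Measurable f)
    {Δf : Finset V} (hfdep : DependsOn f (↑Δf : Set V)) {Mf : ℝ} (hMf : ∀ σ, |f σ| ≤ Mf)
    (hgm : Measurable g) {Δg : Finset V} (hgdep : DependsOn g (↑Δg : Set V)) {Mg : ℝ}
    (hMg : ∀ σ, |g σ| ≤ Mg) (hsep : ∀ y ∈ S.closure Δf, y ∉ Δg) (ℓ : V → ℕ)
    (hℓ0 : ∀ y ∈ S.closure Δg, ℓ y = 0) (hℓ : ∀ x ∉ S.closure Δg, ∀ y ∈ S.nbr x, ℓ x ≤ ℓ y + 1) :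
    |(∫ σ, f σ * g σ ∂(frozenSuMeasure S F N β)) -
        (∫ σ, f σ ∂(frozenSuMeasure S F N β)) * ∫ σ, g σ ∂(frozenSuMeasure S F N β)| ≤
      2 * (2 * Real.sqrt N) ^ 2 * (∑ _y ∈ S.closure Δg, Mg * suSmoothLip N Dg β) *
        ∑ y ∈ S.closure Δf, c ^ ℓ y * (Mf * suSmoothLip N Dg β) := by
  classical
  haveI : SecondCountableTopology (Matrix (Fin N) (Fin N) ℂ) :=
    inferInstanceAs (SecondCountableTopology (Fin N → Fin N → ℂ))
  haveI : SecondCountableTopology (Matrix.specialUnitaryGroup (Fin N) ℂ) :=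
    Topology.IsEmbedding.subtypeVal.secondCountableTopology
  set μ := frozenSuMeasure S F N β with hμdef
  have hw := continuous_suWeight (N := N) β
  have hEm := measurable_frozenEnergy S F (G := Matrix.specialUnitaryGroup (Fin N) ℂ) hw
  have hEb := exists_abs_frozenEnergy_le S F (G := Matrix.specialUnitaryGroup (Fin N) ℂ) hw
  have hγ := isSpecification_weightSpec (V := V) (G := Matrix.specialUnitaryGroup (Fin N) ℂ) hEm hEb
  have hG : IsGibbsMeasure (weightSpec (frozenEnergy S F (suWeight N β))) μ := isGibbsMeasure_weightMeasure hEm hEb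
  haveI : IsProbabilityMeasure μ := hG.isProbabilityMeasure
  have hN0 : (0 : ℝ) < N := by exact_mod_cast (show 0 < N by omega)
  have hKR := isKRContraction_frozen_su S F hN hK hdeg hR hmod (β := β)
  -- the smoothed observables
  set fb := specAvg (weightSpec (frozenEnergy S F (suWeight N β))) Δf f with hfb
  set gb := specAvg (weightSpec (frozenEnergy S F (suWeight N β))) Δg g with hgb
  have hfbm : Measurable fb := measurable_specAvg hγ Δf hfm
  have hgbm : Measurable gb := measurable_specAvg hγ Δg hgm
  have hfbM : ∀ σ, |fb σ| ≤ Mf := abs_specAvg_le hγ Δf hMf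
  have hgbM : ∀ σ, |gb σ| ≤ Mg := abs_specAvg_le hγ Δg hMg
  have hfbdep : DependsOn fb (↑(S.closure Δf) : Set V) := dependsOn_specAvg_frozen S F hw Δf hfm hfdep
  have hgbdep : DependsOn gb (↑(S.closure Δg) : Set V) := dependsOn_specAvg_frozen S F hw Δg hgm hgdep
  have hwLip : ∀ (q : P) (k : Fin 4) (U U' : V → Matrix.specialUnitaryGroup (Fin N) ℂ),
      (∀ z, z ≠ S.lk q k → U z = U' z) →
      |suWeight N β (S.hol U q) - suWeight N β (S.hol U' q)| ≤
        |β| * Real.sqrt N * suFrobDist (U (S.lk q k)) (U' (S.lk q k)) :=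
    fun q k U U' hUU' => S.abs_suWeight_hol_sub_le β q k hUU'
  have hD : (0 : ℝ) < 2 * Real.sqrt N := by positivity
  have hfbLip : IsLipBound suFrobDist fb fun _ => Mf * suSmoothLip N Dg β :=
    isLipBound_specAvg_frozen S F hw suFrobDist_nonneg hD suFrobDist_le (by positivity) hwLip hDg hdeg Δf hfm hfdep
      hMf
  have hgbLip : IsLipBound suFrobDist gb fun _ => Mg * suSmoothLip N Dg β :=
    isLipBound_specAvg_frozen S F hw suFrobDist_nonneg hD suFrobDist_le (by positivity) hwLip hDg hdeg Δg hgm hgdep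
      hMg
  -- DLR identities: smoothing does not change the three integrals
  have h1 : ∫ σ, f σ * g σ ∂μ = ∫ σ, fb σ * gb σ ∂μ := by
    have ha : ∫ η, fb η * g η ∂μ = ∫ σ, f σ * g σ ∂μ :=
      integral_specAvg_mul hγ hG Δf hfm hMf hgm hMg hgdep fun x hx => hsep x (S.subset_closure Δf hx)
    have hb : ∫ η, gb η * fb η ∂μ = ∫ σ, g σ * fb σ ∂μ :=
      integral_specAvg_mul hγ hG Δg hgm hMg hfbm hfbM hfbdep fun x hx hx' => hsep x hx' hx
    rw [← ha]
    have hb' : ∫ η, fb η * gb η ∂μ = ∫ σ, fb σ * g σ ∂μ := by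
      simp_rw [mul_comm (fb _)]
      exact hb
    exact hb'.symm
  have h2 : ∫ σ, f σ ∂μ = ∫ σ, fb σ ∂μ := (integral_specAvg hγ hG Δf hfm hMf).symm
  have h3 : ∫ σ, g σ ∂μ = ∫ σ, gb σ ∂μ := (integral_specAvg hγ hG Δg hgm hMg).symm
  rw [h1, h2, h3]
  have key := abs_covariance_le_of_isKRContraction hγ hKR (r := suFrobDist) (R := 2 * Real.sqrt N)
    suFrobDist_nonneg suFrobDist_le hD.le hc0 hc1 hrow hG hfbm hfbdep hfbM hfbLip hgbm hgbdep hgbM hgbLip ℓ hℓ0 hℓ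
  have hcov : cov[fb, gb; μ] = (∫ σ, fb σ * gb σ ∂μ) - (∫ σ, fb σ ∂μ) * ∫ σ, gb σ ∂μ := by
    rw [covariance_eq_sub]
    · rfl
    · exact memLp_of_bounded (a := -Mf) (b := Mf) (ae_of_all _ fun σ => abs_le.1 (hfbM σ))
        hfbm.aestronglyMeasurable 2
    · exact memLp_of_bounded (a := -Mg) (b := Mg) (ae_of_all _ fun σ => abs_le.1 (hgbM σ))
        hgbm.aestronglyMeasurable 2
  rw [hcov] at key
  exact key

end Covariance

end Summit.QuantumFields.BalabanUV.InfraRed.StrongCouplingFrozenPlaqKR
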